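import Literature.Analysis.FunctionSpaces.LorentzDyadic
import Literature.Analysis.FunctionSpaces.DyadicShellSummation
import Literature.Analysis.FunctionSpaces.LittlewoodPaleyBernsteinProofs
import Literature.Analysis.FluidPDE.NSCriticalClosureBesovProofs
import Literature.Analysis.FluidPDE.CriticalSpacesProofs
import Literature.Analysis.FluidPDE.CriticalRegularityProofs
import Literature.Analysis.FluidPDE.LittlewoodPaleyBlockFn
import HarnessLib

/-!
# The embedding `L^{3,q}(ℝ³) ⊂ Ḃ^{-1+3/r}_{r,q}(ℝ³)`, `3 < r < ∞`, `1 ≤ q < ∞`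

Analysis/FluidPDE file (PROVED theorem; it lives next to `IsDistributionOf`, the tree's dictionary
between real vector fields and their complexified tempered distributions).  The critical Lorentz
space embeds into the critical negative Besov spaces:

  `‖f‖_{Ḃ^{-1+3/r}_{r,q}} ≤ C ‖f‖_{L^{3,q}}`,  `3 < r < ∞`, `1 ≤ q < ∞`,

printed (for `r = q > 3`) by N. C. Phuc, J. Math. Fluid Mech. 17 (2015) 741–760, remark after
Thm 1.7 (arXiv:1407.5129 p. 4: "for `q > 3`, `L^{3,q}(ℝ³) ⊂ Ḃ^{-1+3/q}_{q,q}(ℝ³)`"), and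
classically obtained by real interpolation (`L^{3,q} = (L^{p₀}, L^{p₁})_{θ,q}`,
`L^{p} ⊂ Ḃ^{3/r-3/p}_{r,∞}`, Bergh–Löfström Thms 5.3.1, 6.4.5).  In the tree's vocabulary
(`lorentz_three_subset_homBesov`): for every a.e.-strongly measurable `f : ℝ³ → ℝ^ι` with finite
Lorentz functional `eLorentzNormPow f 3 q < ∞` (`= 3⁻¹‖f‖^q_{L^{3,q}}`, `LorentzPQ.lean`) there is
a tempered distribution `U` with `IsDistributionOf f U` and
`eHomBesovNorm (-1+3/r) r q U ≤ C · (eLorentzNormPow f 3 q)^{1/q}`, `C = C(r, q)` finite.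

## Proof (interpolation-free, dyadic layers)

With `d_k = |{2^k < |f|}|`, `c_k = d_k^{1/3}`, `a_k = 2^k c_k` (so `∑_k a_k^q ≤ 2^q eLorentzNormPow`,
`LorentzDyadic.lean`): for each block `j` split `f = h_j + ℓ_j` along the dyadic layers
`2^k < |f| ≤ 2^{k+1}` with `k ∈ H_j = {2^j c_k ≤ 1}` resp. `k ∉ H_j`; then
`‖h_j‖_{L¹} ≤ ∑_{H_j} 2^{k+1} d_k`, `‖ℓ_j‖^r_{L^r} ≤ ∑_{H_jᶜ} 2^{(k+1)r} d_k` (`LorentzDyadic.lean`),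
`U = [h_j] + [ℓ_j]` (`isDistributionOf_toTemperedDistribution`, uniqueness), and by Bernstein
`L¹ → L^r` on the block of `h_j` (`exists_eLpNormDistrib_lpBlock_le`) and the uniform `L^p` bound
on blocks (`exists_eLpNormDistrib_lpBlock_le_eLpNormDistrib`),
`2^{j(3/r-1)} ‖Δ̇_j U‖_{L^r} ≤ K ∑_k a_k φ(2^j c_k)` with the two-sided bump `φ(x) = x²` (`x ≤ 1`),
`x^{-(1-3/r)}` (`x > 1`).  The `ℓ^q_j` norm of the right-hand side is `≲ ‖a‖_{ℓ^q}` by the shell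
summation lemma `tsum_rpow_tsum_dyadicBump_le` (`DyadicShellSummation.lean`).

## References

* N. C. Phuc, *The Navier–Stokes equations in nonendpoint borderline Lorentz spaces*, J. Math.
  Fluid Mech. 17 (2015) 741–760 = arXiv:1407.5129, remark after Thm 1.7 (p. 4). [Phuc2015]
* H. Bahouri, J.-Y. Chemin, R. Danchin, *Fourier Analysis and Nonlinear PDE*, Springer 2011,
  Lemma 2.1 (Bernstein), Def. 2.15. [BahouriCheminDanchin2011]
* L. Grafakos, *Classical Fourier Analysis*, 3rd ed., §1.4 (Lorentz spaces). [Grafakos2014]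
-/

noncomputable section

open MeasureTheory Set Function Filter SchwartzMap
open Literature.Analysis.FunctionSpaces
open scoped ENNReal NNReal Topology

namespace Literature.Analysis.FluidPDE

section Helpers

/-- Sub-additivity of `x ↦ x^s`, `0 < s ≤ 1`, over a series in `[0, ∞]`:
`(∑_k x_k)^s ≤ ∑_k x_k^s`. [folklore] -/
private theorem rpow_tsum_le_tsum_rpow {κ : Type*} (x : κ → ℝ≥0∞) {s : ℝ} (hs0 : 0 < s)
    (hs1 : s ≤ 1) : (∑' k, x k) ^ s ≤ ∑' k, (x k) ^ s := by
  classical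
  -- with `y_k = x_k^s` and `t = 1/s ≥ 1`: `∑ y_k^t ≤ (∑ y_k)^t`
  set t : ℝ := 1 / s with ht
  have ht1 : 1 ≤ t := by rw [ht, le_div_iff₀ hs0]; linarith
  have ht0 : 0 < t := by linarith
  have hxy : ∀ k, x k = ((x k) ^ s) ^ t := fun k => by
    rw [← ENNReal.rpow_mul, ht, mul_one_div_cancel hs0.ne', ENNReal.rpow_one]
  have hsuper : ∑' k, ((x k) ^ s) ^ t ≤ (∑' k, (x k) ^ s) ^ t := by
    rw [ENNReal.tsum_eq_iSup_sum]
    refine iSup_le fun F => ?_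
    calc ∑ k ∈ F, ((x k) ^ s) ^ t ≤ (∑ k ∈ F, (x k) ^ s) ^ t := by
          induction F using Finset.induction_on with
          | empty => simp
          | insert a F ha ih =>
            rw [Finset.sum_insert ha, Finset.sum_insert ha]
            exact (add_le_add le_rfl ih).trans (ENNReal.add_rpow_le_rpow_add _ _ ht1)
      _ ≤ (∑' k, (x k) ^ s) ^ t := ENNReal.rpow_le_rpow (ENNReal.sum_le_tsum F) ht0.le
  calc (∑' k, x k) ^ s = (∑' k, ((x k) ^ s) ^ t) ^ s := by
        congr 1; exact tsum_congr hxy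
    _ ≤ ((∑' k, (x k) ^ s) ^ t) ^ s := ENNReal.rpow_le_rpow hsuper hs0.le
    _ = ∑' k, (x k) ^ s := by
        rw [← ENNReal.rpow_mul, ht, one_div_mul_cancel hs0.ne', ENNReal.rpow_one]

variable {α : Type*} [MeasurableSpace α] {μ : Measure α} {V : Type*} [NormedAddCommGroup V]

/-- The union of a family of dyadic layers of an a.e.-strongly measurable field is null-measurable.
[folklore] -/
private theorem nullMeasurableSet_layers {f : α → V} (hf : AEStronglyMeasurable f μ) (H : Set ℤ) :
    NullMeasurableSet {x | ∃ k ∈ H, (2 : ℝ) ^ k < ‖f x‖ ∧ ‖f x‖ ≤ (2 : ℝ) ^ (k + 1)} μ := by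
  have hset : {x | ∃ k ∈ H, (2 : ℝ) ^ k < ‖f x‖ ∧ ‖f x‖ ≤ (2 : ℝ) ^ (k + 1)} =
      ⋃ k : ℤ, ⋃ (_ : k ∈ H), ({x | (2 : ℝ) ^ k < ‖f x‖} ∩ {x | ‖f x‖ ≤ (2 : ℝ) ^ (k + 1)}) := by
    ext x
    simp only [mem_setOf_eq, mem_iUnion, mem_inter_iff, exists_prop]
  rw [hset]
  refine NullMeasurableSet.iUnion fun k => NullMeasurableSet.iUnion fun _ => ?_
  exact (nullMeasurableSet_lt aemeasurable_const hf.norm.aemeasurable).inter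
    (nullMeasurableSet_le hf.norm.aemeasurable aemeasurable_const)

/-- `ℝ≥0∞` algebra of the high layers: `2^{2j} · (2^{k+1} c³) = 2 · (2^k c) · (2^j c)²`. [folklore] -/
private theorem two_rpow_high_layer (j k : ℤ) (c : ℝ≥0∞) :
    (2 : ℝ≥0∞) ^ (2 * (j : ℝ)) * ((2 : ℝ≥0∞) ^ ((k : ℝ) + 1) * c ^ (3 : ℝ)) =
      2 * (((2 : ℝ≥0∞) ^ (k : ℝ) * c) * ((2 : ℝ≥0∞) ^ (j : ℝ) * c) ^ (2 : ℝ)) := by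
  rw [ENNReal.mul_rpow_of_nonneg _ _ (by norm_num : (0 : ℝ) ≤ 2), ← ENNReal.rpow_mul]
  have h3 : c ^ (3 : ℝ) = c * c ^ (2 : ℝ) := by
    rw [show (3 : ℝ) = 1 + 2 by norm_num, ENNReal.rpow_add_of_nonneg _ _ zero_le_one zero_le_two,
      ENNReal.rpow_one]
  have h21 : (2 : ℝ≥0∞) ^ ((k : ℝ) + 1) = (2 : ℝ≥0∞) ^ (k : ℝ) * 2 := by
    rw [ENNReal.rpow_add _ _ two_ne_zero ENNReal.ofNat_ne_top, ENNReal.rpow_one]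
  rw [h3, h21]
  have h22 : (2 : ℝ≥0∞) ^ (2 * (j : ℝ)) = (2 : ℝ≥0∞) ^ ((j : ℝ) * 2) := by ring_nf
  rw [h22]
  ring

/-- `ℝ≥0∞` algebra of the low layers: for `c ≠ 0, ∞` and `s = -1 + 3/r'`,
`2^{js} · (2^{k+1} (c³)^{1/r'}) = 2 · (2^k c) · (2^j c)^s`. [folklore] -/
private theorem two_rpow_low_layer (j k : ℤ) {c : ℝ≥0∞} (hc0 : c ≠ 0) (hct : c ≠ ⊤) (r' : ℝ) :
    (2 : ℝ≥0∞) ^ ((j : ℝ) * (-1 + 3 / r')) *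
        ((2 : ℝ≥0∞) ^ ((k : ℝ) + 1) * (c ^ (3 : ℝ)) ^ (1 / r')) =
      2 * (((2 : ℝ≥0∞) ^ (k : ℝ) * c) * ((2 : ℝ≥0∞) ^ (j : ℝ) * c) ^ (-1 + 3 / r')) := by
  have h2j0 : (2 : ℝ≥0∞) ^ (j : ℝ) ≠ 0 := ne_of_gt (ENNReal.rpow_pos two_pos ENNReal.ofNat_ne_top)
  rw [ENNReal.mul_rpow_of_ne_zero h2j0 hc0, ← ENNReal.rpow_mul, ← ENNReal.rpow_mul]
  have hc : c ^ (3 * (1 / r')) = c * c ^ (-1 + 3 / r') := by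
    rw [show 3 * (1 / r') = 1 + (-1 + 3 / r') by ring, ENNReal.rpow_add _ _ hc0 hct,
      ENNReal.rpow_one]
  have h21 : (2 : ℝ≥0∞) ^ ((k : ℝ) + 1) = (2 : ℝ≥0∞) ^ (k : ℝ) * 2 := by
    rw [ENNReal.rpow_add _ _ two_ne_zero ENNReal.ofNat_ne_top, ENNReal.rpow_one]
  rw [hc, h21]
  ring

/-- Indicators commute with positive powers in `[0, ∞]`. [folklore] -/
private theorem indicator_rpow_of_pos {κ : Type*} (S : Set κ) (g : κ → ℝ≥0∞) {p : ℝ} (hp : 0 < p)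
    (k : κ) : (S.indicator g k) ^ p = S.indicator (fun k => (g k) ^ p) k := by
  classical
  by_cases hk : k ∈ S
  · rw [indicator_of_mem hk, indicator_of_mem hk]
  · rw [indicator_of_notMem hk, indicator_of_notMem hk, ENNReal.zero_rpow_of_pos hp]

end Helpers

section Main

variable {ι : Type*} [Fintype ι]

/-- **`L^{3,q}(ℝ³) ⊂ Ḃ^{-1+3/r}_{r,q}(ℝ³)`** (`3 < r < ∞`, `1 ≤ q < ∞`; Phuc 2015, remark after
Thm 1.7, for `r = q`; real interpolation in general).  For every a.e.-strongly measurable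
`f : ℝ³ → ℝ^ι` with `eLorentzNormPow f 3 q < ∞` there is a tempered distribution `U` representing
`f` (`IsDistributionOf f U`) with
`‖U‖_{Ḃ^{-1+3/r}_{r,q}} ≤ C · (eLorentzNormPow f 3 q)^{1/q}` (`= C 3^{-1/q} ‖f‖_{L^{3,q}}`), the
constant `C < ∞` depending only on `r`, `q` (and `ι`).  Proof: dyadic layers + Bernstein, see the
module docstring. [cite: Phuc2015, remark following Thm. 1.7 (arXiv:1407.5129 p. 4)] -/
theorem lorentz_three_subset_homBesov (r q : ℝ≥0∞) [Fact (1 ≤ r)] (h3r : 3 < r) (hrtop : r < ⊤)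
    (h1q : 1 ≤ q) (hqtop : q < ⊤) :
    ∃ C : ℝ≥0∞, C < ⊤ ∧ ∀ f : EuclideanSpace ℝ (Fin 3) → EuclideanSpace ℝ ι,
      AEStronglyMeasurable f volume → eLorentzNormPow f 3 q volume < ⊤ →
        ∃ U : 𝓢'(EuclideanSpace ℝ (Fin 3), EuclideanSpace ℂ ι), IsDistributionOf f U ∧
          eHomBesovNorm (-1 + 3 / r.toReal) r q U ≤
            C * eLorentzNormPow f 3 q volume ^ (1 / q.toReal) := by
  classical
  -- exponents
  have hr3 : (3 : ℝ) < r.toReal := by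
    have h := (ENNReal.toReal_lt_toReal (by norm_num) hrtop.ne).2 h3r
    simpa using h
  have hr0 : 0 < r.toReal := by linarith
  have hq1 : 1 ≤ q.toReal := by
    have h := (ENNReal.toReal_le_toReal ENNReal.one_ne_top hqtop.ne).2 h1q
    simpa using h
  have hq0 : 0 < q.toReal := by linarith
  have hq0' : q ≠ 0 := ne_of_gt (lt_of_lt_of_le zero_lt_one h1q)
  set r' : ℝ := r.toReal with hr'
  set q' : ℝ := q.toReal with hq'
  set s : ℝ := -1 + 3 / r' with hs
  have hβ : 0 < 1 - 3 / r' := by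
    rw [sub_pos, div_lt_one hr0]; exact hr3
  have hs' : s = -(1 - 3 / r') := by rw [hs]; ring
  haveI h11 : Fact (1 ≤ (1 : ℝ≥0∞)) := ⟨le_rfl⟩
  -- constants
  obtain ⟨CB, -, hCB⟩ := exists_eLpNormDistrib_lpBlock_le (E := EuclideanSpace ℝ (Fin 3))
    (F := EuclideanSpace ℂ ι) 1 r (Fact.out)
  obtain ⟨C1, hC1⟩ := exists_eLpNormDistrib_lpBlock_le_eLpNormDistrib
    (E := EuclideanSpace ℝ (Fin 3)) (F := EuclideanSpace ℂ ι) 1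
  obtain ⟨Cr, hCr⟩ := exists_eLpNormDistrib_lpBlock_le_eLpNormDistrib
    (E := EuclideanSpace ℝ (Fin 3)) (F := EuclideanSpace ℂ ι) r
  obtain ⟨CS, hCStop, hCS⟩ := tsum_rpow_tsum_dyadicBump_le (α := 2) (β := 1 - 3 / r') (q := q')
    two_pos hβ hq1
  set K : ℝ≥0∞ := 2 * ((CB : ℝ≥0∞) * C1 + Cr) with hK
  have hKtop : K < ⊤ := by
    rw [hK]
    exact ENNReal.mul_lt_top ENNReal.ofNat_lt_top (ENNReal.add_lt_top.2
      ⟨ENNReal.mul_lt_top ENNReal.coe_lt_top ENNReal.coe_lt_top, ENNReal.coe_lt_top⟩)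
  clear_value K
  refine ⟨K * CS ^ (1 / q') * 2, ?_, fun f hf hLor => ?_⟩
  · exact ENNReal.mul_lt_top (ENNReal.mul_lt_top hKtop
      (ENNReal.rpow_lt_top_of_nonneg (by positivity) hCStop.ne)) ENNReal.ofNat_lt_top
  -- the dyadic data of `f`
  set d : ℤ → ℝ≥0∞ := fun k => volume {x | (2 : ℝ) ^ k < ‖f x‖} with hd
  set c : ℤ → ℝ≥0∞ := fun k => (d k) ^ (1 / (3 : ℝ)) with hc
  set a : ℤ → ℝ≥0∞ := fun k => (2 : ℝ≥0∞) ^ (k : ℝ) * c k with ha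
  set φ : ℤ → ℤ → ℝ≥0∞ := fun j k =>
    if (2 : ℝ≥0∞) ^ (j : ℝ) * c k ≤ 1 then ((2 : ℝ≥0∞) ^ (j : ℝ) * c k) ^ (2 : ℝ)
      else ((2 : ℝ≥0∞) ^ (j : ℝ) * c k) ^ (-(1 - 3 / r')) with hφ
  set S : ℤ → ℝ≥0∞ := fun j => ∑' k, a k * φ j k with hS
  have hd_top : ∀ k, d k < ⊤ := fun k =>
    measure_setOf_two_zpow_lt_norm_lt_top f volume (p := 3) (by norm_num) ENNReal.ofNat_ne_top
      h1q hqtop.ne hLor k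
  have hc_top : ∀ k, c k ≠ ⊤ := fun k =>
    ENNReal.rpow_ne_top_of_nonneg (by norm_num) (hd_top k).ne
  have hcd : ∀ k, (c k) ^ (3 : ℝ) = d k := fun k => by
    simp only [hc]
    rw [← ENNReal.rpow_mul, one_div_mul_cancel (by norm_num : (3 : ℝ) ≠ 0), ENNReal.rpow_one]
  have h2ne : ∀ y : ℝ, (2 : ℝ≥0∞) ^ y ≠ 0 := fun y =>
    ne_of_gt (ENNReal.rpow_pos two_pos ENNReal.ofNat_ne_top)
  have h2nt : ∀ y : ℝ, (2 : ℝ≥0∞) ^ y ≠ ⊤ := fun y =>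
    ENNReal.rpow_ne_top_of_ne_zero two_ne_zero ENNReal.ofNat_ne_top
  -- Lorentz control of the dyadic sequence
  have ha_le : ∑' k, (a k) ^ q' ≤ (2 : ℝ≥0∞) ^ q' * eLorentzNormPow f 3 q volume := by
    have h := tsum_two_rpow_mul_measure_rpow_le_eLorentzNormPow f volume (p := 3) h1q hqtop.ne
    have h3 : (3 : ℝ≥0∞).toReal = 3 := by norm_num
    rw [h3] at h
    refine le_trans (le_of_eq (tsum_congr fun k => ?_)) h
    simp only [ha, hc]
    rw [ENNReal.mul_rpow_of_nonneg _ _ hq0.le, ← ENNReal.rpow_mul, ← ENNReal.rpow_mul]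
    congr 2
    ring
  have hLor2 : (2 : ℝ≥0∞) ^ q' * eLorentzNormPow f 3 q volume < ⊤ :=
    ENNReal.mul_lt_top (ENNReal.rpow_lt_top_of_nonneg hq0.le ENNReal.ofNat_ne_top) hLor
  -- shell summation
  have hSsum : ∑' j, (S j) ^ q' ≤ CS * ∑' k, (a k) ^ q' := hCS c
  have hStop : ∀ j : ℤ, S j < ⊤ := by
    intro j
    have h1 : (S j) ^ q' ≤ ∑' j, (S j) ^ q' := ENNReal.le_tsum j
    have h2 : (S j) ^ q' < ⊤ := lt_of_le_of_lt (h1.trans hSsum)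
      (ENNReal.mul_lt_top hCStop (lt_of_le_of_lt ha_le hLor2))
    exact (ENNReal.rpow_lt_top_iff_of_pos hq0).1 h2
  -- the layered splitting, block by block: `H j` = high layers (the `L¹` piece)
  set H : ℤ → Set ℤ := fun j => {k : ℤ | (2 : ℝ≥0∞) ^ (j : ℝ) * c k ≤ 1} with hH
  set X : ℤ → Set (EuclideanSpace ℝ (Fin 3)) := fun j =>
    {x | ∃ k ∈ H j, (2 : ℝ) ^ k < ‖f x‖ ∧ ‖f x‖ ≤ (2 : ℝ) ^ (k + 1)} with hX
  set h : ℤ → EuclideanSpace ℝ (Fin 3) → EuclideanSpace ℝ ι := fun j => (X j).indicator f with hh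
  set ℓ : ℤ → EuclideanSpace ℝ (Fin 3) → EuclideanSpace ℝ ι := fun j => f - h j with hℓ
  set I1 : ℤ → ℝ≥0∞ := fun j =>
    ∑' k, (H j).indicator (fun k => (2 : ℝ≥0∞) ^ ((k : ℝ) + 1) * d k) k with hI1def
  set I2 : ℤ → ℝ≥0∞ := fun j =>
    ∑' k, (H j)ᶜ.indicator (fun k => (2 : ℝ≥0∞) ^ (((k : ℝ) + 1) * r') * d k) k with hI2def
  -- (i) sizes of the pieces (dyadic layer bounds)
  have hI1 : ∀ j : ℤ, ∫⁻ x, ‖h j x‖ₑ ≤ I1 j := fun j => lintegral_enorm_layers_le_tsum hf (H j)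
  have hI2 : ∀ j : ℤ, ∫⁻ x, ‖ℓ j x‖ₑ ^ r' ≤ I2 j := by
    intro j
    calc ∫⁻ x, ‖ℓ j x‖ₑ ^ r'
        ≤ ∫⁻ x, ‖{x | ∃ k ∈ (H j)ᶜ, (2 : ℝ) ^ k < ‖f x‖ ∧ ‖f x‖ ≤ (2 : ℝ) ^ (k + 1)}.indicator
            f x‖ₑ ^ r' := by
          refine lintegral_mono fun x => ENNReal.rpow_le_rpow ?_ hr0.le
          rw [← ofReal_norm, ← ofReal_norm]
          exact ENNReal.ofReal_le_ofReal (norm_sub_indicator_layers_le f (H j) x)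
      _ ≤ I2 j := lintegral_enorm_rpow_layers_le_tsum hf (H j)ᶜ hr0
  -- (ii) the sizes against the bump sums: `2^{2j} I1 j ≤ 2 S j`, `2^{js} (I2 j)^{1/r'} ≤ 2 S j`
  have hI1S : ∀ j : ℤ, (2 : ℝ≥0∞) ^ (2 * (j : ℝ)) * I1 j ≤ 2 * S j := by
    intro j
    simp only [hI1def, hS]
    rw [← ENNReal.tsum_mul_left, ← ENNReal.tsum_mul_left]
    refine ENNReal.tsum_le_tsum fun k => ?_
    by_cases hk : k ∈ H j
    · have hk' : (2 : ℝ≥0∞) ^ (j : ℝ) * c k ≤ 1 := hk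
      rw [indicator_of_mem hk, ← hcd k, two_rpow_high_layer]
      have hφk : φ j k = ((2 : ℝ≥0∞) ^ (j : ℝ) * c k) ^ (2 : ℝ) := by
        simp only [hφ]
        rw [if_pos hk']
      rw [hφk]
    · rw [indicator_of_notMem hk, mul_zero]
      exact bot_le
  have hI2S : ∀ j : ℤ, (2 : ℝ≥0∞) ^ ((j : ℝ) * s) * (I2 j) ^ (1 / r') ≤ 2 * S j := by
    intro j
    have hr1' : 1 / r' ≤ 1 := by rw [div_le_one hr0]; linarith
    have hsub : (I2 j) ^ (1 / r') ≤
        ∑' k, (H j)ᶜ.indicator (fun k => (2 : ℝ≥0∞) ^ ((k : ℝ) + 1) * (d k) ^ (1 / r')) k := by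
      refine (rpow_tsum_le_tsum_rpow _ (by positivity) hr1').trans (le_of_eq (tsum_congr fun k => ?_))
      rw [indicator_rpow_of_pos _ _ (by positivity)]
      by_cases hk : k ∈ (H j)ᶜ
      · rw [indicator_of_mem hk, indicator_of_mem hk, ENNReal.mul_rpow_of_nonneg _ _ (by positivity),
          ← ENNReal.rpow_mul, show ((k : ℝ) + 1) * r' * (1 / r') = (k : ℝ) + 1 by field_simp]
      · rw [indicator_of_notMem hk, indicator_of_notMem hk]
    calc (2 : ℝ≥0∞) ^ ((j : ℝ) * s) * (I2 j) ^ (1 / r')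
        ≤ (2 : ℝ≥0∞) ^ ((j : ℝ) * s) *
            ∑' k, (H j)ᶜ.indicator (fun k => (2 : ℝ≥0∞) ^ ((k : ℝ) + 1) * (d k) ^ (1 / r')) k :=
          mul_le_mul' le_rfl hsub
      _ = ∑' k, (2 : ℝ≥0∞) ^ ((j : ℝ) * s) *
            (H j)ᶜ.indicator (fun k => (2 : ℝ≥0∞) ^ ((k : ℝ) + 1) * (d k) ^ (1 / r')) k :=
          ENNReal.tsum_mul_left.symm
      _ ≤ ∑' k, 2 * (a k * φ j k) := by
          refine ENNReal.tsum_le_tsum fun k => ?_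
          by_cases hk : k ∈ (H j)ᶜ
          · have hk' : ¬ ((2 : ℝ≥0∞) ^ (j : ℝ) * c k ≤ 1) := hk
            have hc0 : c k ≠ 0 := by
              intro h0
              apply hk'
              rw [h0, mul_zero]
              exact zero_le_one
            rw [indicator_of_mem hk, ← hcd k, hs, two_rpow_low_layer j k hc0 (hc_top k) r']
            have hφk : φ j k = ((2 : ℝ≥0∞) ^ (j : ℝ) * c k) ^ (-(1 - 3 / r')) := by
              simp only [hφ]
              rw [if_neg hk']
            rw [hφk, show -(1 - 3 / r') = -1 + 3 / r' by ring]
          · rw [indicator_of_notMem hk, mul_zero]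
            exact bot_le
      _ = 2 * S j := by rw [ENNReal.tsum_mul_left]
  -- (iii) integrability of the pieces
  have hXnull : ∀ j : ℤ, NullMeasurableSet (X j) volume := fun j => nullMeasurableSet_layers hf (H j)
  have hh_meas : ∀ j : ℤ, AEStronglyMeasurable (h j) volume := fun j => hf.indicator₀ (hXnull j)
  have hℓ_meas : ∀ j : ℤ, AEStronglyMeasurable (ℓ j) volume := fun j => hf.sub (hh_meas j)
  have hI1top : ∀ j : ℤ, I1 j < ⊤ := by
    intro j
    have hle : I1 j ≤ ((2 : ℝ≥0∞) ^ (2 * (j : ℝ)))⁻¹ * (2 * S j) := by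
      calc I1 j = ((2 : ℝ≥0∞) ^ (2 * (j : ℝ)))⁻¹ * ((2 : ℝ≥0∞) ^ (2 * (j : ℝ)) * I1 j) := by
            rw [← mul_assoc, ENNReal.inv_mul_cancel (h2ne _) (h2nt _), one_mul]
        _ ≤ ((2 : ℝ≥0∞) ^ (2 * (j : ℝ)))⁻¹ * (2 * S j) := mul_le_mul' le_rfl (hI1S j)
    exact lt_of_le_of_lt hle (ENNReal.mul_lt_top (ENNReal.inv_lt_top.2
      (ENNReal.rpow_pos two_pos ENNReal.ofNat_ne_top)) (ENNReal.mul_lt_top ENNReal.ofNat_lt_top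
      (hStop j)))
  have hI2top : ∀ j : ℤ, I2 j < ⊤ := by
    intro j
    have hle : (I2 j) ^ (1 / r') ≤ ((2 : ℝ≥0∞) ^ ((j : ℝ) * s))⁻¹ * (2 * S j) := by
      calc (I2 j) ^ (1 / r')
          = ((2 : ℝ≥0∞) ^ ((j : ℝ) * s))⁻¹ * ((2 : ℝ≥0∞) ^ ((j : ℝ) * s) * (I2 j) ^ (1 / r')) := by
            rw [← mul_assoc, ENNReal.inv_mul_cancel (h2ne _) (h2nt _), one_mul]
        _ ≤ ((2 : ℝ≥0∞) ^ ((j : ℝ) * s))⁻¹ * (2 * S j) := mul_le_mul' le_rfl (hI2S j)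
    have hlt : (I2 j) ^ (1 / r') < ⊤ :=
      lt_of_le_of_lt hle (ENNReal.mul_lt_top (ENNReal.inv_lt_top.2
        (ENNReal.rpow_pos two_pos ENNReal.ofNat_ne_top)) (ENNReal.mul_lt_top ENNReal.ofNat_lt_top
        (hStop j)))
    exact (ENNReal.rpow_lt_top_iff_of_pos (by positivity)).1 hlt
  have hr_ne0 : r ≠ 0 := ne_of_gt (lt_trans (by norm_num) h3r)
  have hh_mem : ∀ j : ℤ, MemLp (h j) 1 volume := fun j =>
    ⟨hh_meas j, by rw [eLpNorm_one_eq_lintegral_enorm]; exact lt_of_le_of_lt (hI1 j) (hI1top j)⟩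
  have hℓ_mem : ∀ j : ℤ, MemLp (ℓ j) r volume := fun j =>
    ⟨hℓ_meas j, by
      rw [eLpNorm_eq_lintegral_rpow_enorm_toReal hr_ne0 hrtop.ne]
      exact ENNReal.rpow_lt_top_of_nonneg (by positivity)
        (lt_of_le_of_lt (hI2 j) (hI2top j)).ne⟩
  -- (iv) the distributions of the pieces and of `f`
  set Th : ℤ → 𝓢'(EuclideanSpace ℝ (Fin 3), EuclideanSpace ℂ ι) := fun j =>
    Lp.toTemperedDistribution ((memLp_complexify_comp (hh_mem j)).toLp _) with hTh
  set Tl : ℤ → 𝓢'(EuclideanSpace ℝ (Fin 3), EuclideanSpace ℂ ι) := fun j =>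
    Lp.toTemperedDistribution ((memLp_complexify_comp (hℓ_mem j)).toLp _) with hTl
  have hTh_dist : ∀ j : ℤ, IsDistributionOf (h j) (Th j) := fun j =>
    isDistributionOf_toTemperedDistribution (hh_mem j)
  have hTl_dist : ∀ j : ℤ, IsDistributionOf (ℓ j) (Tl j) := fun j =>
    isDistributionOf_toTemperedDistribution (hℓ_mem j)
  have hU_dist : ∀ j : ℤ, IsDistributionOf f (Th j + Tl j) := by
    intro j
    have hadd := (hTh_dist j).add (hTl_dist j)
    have hsum : h j + ℓ j = f := indicator_layers_add_sub f (H j)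
    rwa [hsum] at hadd
  set U : 𝓢'(EuclideanSpace ℝ (Fin 3), EuclideanSpace ℂ ι) := Th 0 + Tl 0 with hU
  have hUj : ∀ j : ℤ, Th j + Tl j = U := fun j => (hU_dist j).unique (hU_dist 0)
  refine ⟨U, hU_dist 0, ?_⟩
  -- (v) the block estimate `2^{js} ‖Δ̇_j U‖_{L^r} ≤ K S_j`
  have hfin3 : (Module.finrank ℝ (EuclideanSpace ℝ (Fin 3)) : ℝ) = 3 := by
    rw [finrank_euclideanSpace, Fintype.card_fin]; norm_num
  have hexp : ∀ j : ℤ, (2 : ℝ≥0∞) ^ ((j : ℝ) * s) *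
      (2 : ℝ≥0∞) ^ ((j : ℝ) * (Module.finrank ℝ (EuclideanSpace ℝ (Fin 3)) : ℝ) *
        ((1 : ℝ≥0∞).toReal⁻¹ - r.toReal⁻¹)) = (2 : ℝ≥0∞) ^ (2 * (j : ℝ)) := by
    intro j
    have hreal : (j : ℝ) * s + (j : ℝ) * (3 : ℝ) * (1 - r'⁻¹) = 2 * (j : ℝ) := by
      rw [hs]
      field_simp
      ring
    rw [hfin3, ENNReal.toReal_one, inv_one, ← ENNReal.rpow_add _ _ two_ne_zero ENNReal.ofNat_ne_top,
      hreal]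
  have hblock : ∀ j : ℤ, lpBlockWeight s r U j ≤ K * S j := by
    intro j
    rw [lpBlockWeight, ← hUj j, map_add]
    calc (2 : ℝ≥0∞) ^ ((j : ℝ) * s) * eLpNormDistrib r (lpBlock j (Th j) + lpBlock j (Tl j))
        ≤ (2 : ℝ≥0∞) ^ ((j : ℝ) * s) *
            (eLpNormDistrib r (lpBlock j (Th j)) + eLpNormDistrib r (lpBlock j (Tl j))) :=
          mul_le_mul' le_rfl (eLpNormDistrib_add_le _ _)
      _ ≤ (2 : ℝ≥0∞) ^ ((j : ℝ) * s) *
            ((CB : ℝ≥0∞) * (2 : ℝ≥0∞) ^ ((j : ℝ) *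
                (Module.finrank ℝ (EuclideanSpace ℝ (Fin 3)) : ℝ) *
                  ((1 : ℝ≥0∞).toReal⁻¹ - r.toReal⁻¹)) * ((C1 : ℝ≥0∞) * I1 j) +
              (Cr : ℝ≥0∞) * (I2 j) ^ (1 / r')) := by
          refine mul_le_mul' le_rfl (add_le_add ?_ ?_)
          · calc eLpNormDistrib r (lpBlock j (Th j))
                ≤ (CB : ℝ≥0∞) * (2 : ℝ≥0∞) ^ ((j : ℝ) *
                    (Module.finrank ℝ (EuclideanSpace ℝ (Fin 3)) : ℝ) *
                      ((1 : ℝ≥0∞).toReal⁻¹ - r.toReal⁻¹)) * eLpNormDistrib 1 (lpBlock j (Th j)) :=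
                  hCB j (Th j)
              _ ≤ (CB : ℝ≥0∞) * (2 : ℝ≥0∞) ^ ((j : ℝ) *
                    (Module.finrank ℝ (EuclideanSpace ℝ (Fin 3)) : ℝ) *
                      ((1 : ℝ≥0∞).toReal⁻¹ - r.toReal⁻¹)) * ((C1 : ℝ≥0∞) * eLpNormDistrib 1 (Th j)) :=
                  mul_le_mul' le_rfl (hC1 j (Th j))
              _ ≤ _ := by
                  rw [(hTh_dist j).eLpNormDistrib_eq (hh_mem j), eLpNorm_one_eq_lintegral_enorm]
                  exact mul_le_mul' le_rfl (mul_le_mul' le_rfl (hI1 j))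
          · calc eLpNormDistrib r (lpBlock j (Tl j)) ≤ (Cr : ℝ≥0∞) * eLpNormDistrib r (Tl j) :=
                  hCr j (Tl j)
              _ ≤ _ := by
                  rw [(hTl_dist j).eLpNormDistrib_eq (hℓ_mem j),
                    eLpNorm_eq_lintegral_rpow_enorm_toReal hr_ne0 hrtop.ne]
                  exact mul_le_mul' le_rfl (ENNReal.rpow_le_rpow (hI2 j) (by positivity))
      _ = (CB : ℝ≥0∞) * C1 * ((2 : ℝ≥0∞) ^ (2 * (j : ℝ)) * I1 j) +
            Cr * ((2 : ℝ≥0∞) ^ ((j : ℝ) * s) * (I2 j) ^ (1 / r')) := by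
          rw [← hexp j]
          ring
      _ ≤ (CB : ℝ≥0∞) * C1 * (2 * S j) + Cr * (2 * S j) :=
          add_le_add (mul_le_mul' le_rfl (hI1S j)) (mul_le_mul' le_rfl (hI2S j))
      _ = K * S j := by rw [hK]; ring
  -- (vi) the Besov norm
  rw [eHomBesovNorm_eq_tsum_rpow_holds hq0' hqtop.ne U]
  calc (∑' j, (lpBlockWeight s r U j) ^ q') ^ (1 / q')
      ≤ (∑' j, (K * S j) ^ q') ^ (1 / q') :=
        ENNReal.rpow_le_rpow (ENNReal.tsum_le_tsum fun j =>
          ENNReal.rpow_le_rpow (hblock j) hq0.le) (by positivity)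
    _ = (K ^ q' * ∑' j, (S j) ^ q') ^ (1 / q') := by
        congr 1
        rw [← ENNReal.tsum_mul_left]
        exact tsum_congr fun j => ENNReal.mul_rpow_of_nonneg _ _ hq0.le
    _ ≤ (K ^ q' * (CS * ((2 : ℝ≥0∞) ^ q' * eLorentzNormPow f 3 q volume))) ^ (1 / q') :=
        ENNReal.rpow_le_rpow (mul_le_mul' le_rfl (hSsum.trans (mul_le_mul' le_rfl ha_le)))
          (by positivity)
    _ = K * CS ^ (1 / q') * 2 * eLorentzNormPow f 3 q volume ^ (1 / q') := by
        have hq'' : (0 : ℝ) ≤ 1 / q' := by positivity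
        have h1 : (K ^ q') ^ (1 / q') = K := by
          rw [← ENNReal.rpow_mul, mul_one_div_cancel hq0.ne', ENNReal.rpow_one]
        have h2 : ((2 : ℝ≥0∞) ^ q') ^ (1 / q') = 2 := by
          rw [← ENNReal.rpow_mul, mul_one_div_cancel hq0.ne', ENNReal.rpow_one]
        rw [ENNReal.mul_rpow_of_nonneg _ _ hq'', ENNReal.mul_rpow_of_nonneg _ _ hq'',
          ENNReal.mul_rpow_of_nonneg _ _ hq'', h1, h2]
        ring

end Main

end Literature.Analysis.FluidPDE

end
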